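import Summits.QuantumFields.BalabanUV.Beta.SymBorderJetWardFluct
import Summits.QuantumFields.BalabanUV.Beta.BorderWardSiteLawFluct
import Summits.QuantumFields.BalabanUV.Beta.SymAveragingMixedJetStructure

/-!
# `BalabanUV.Beta.SymBorderWardSiteLawFluct` — binder row D1, «GAUGE-LETTERS» (G4-B′σ): **THE SITE LAW OF THE (0.4)-SYMMETRISED BORDER TABLE
# `symVh2Tab` IN ITS FIRST (FLUCTUATION) SLOT, AT EVERY SITE** — the pair-family twin of G4-B′ `BorderWardSiteLawFluct` (the `(0,3)`-entries of G3′σ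
# `SymBorderJetWardFluct.symT2At_gauge_fluct` at matrix-unit letters); this is the table behind the (0.4) record's `symVh₂SAt ∕ symVh₂SAn1`, i.e. behind the
# (STEP) door's `hQ₁₂ ∕ hQ₂₂` bi-families (U21) (β sub-cell; D1 formalisation swarm LEAF PROVER 02, road «FP» ROUTE T, (COV-m) order 2)

HONEST FRAMING (cell charter, verbatim): «discharging BetaPertH makes Balaban's UV stability UNCONDITIONAL — a real
constructive-QFT result; it is NOT the continuum limit and NOT the Clay problem.»
HONEST DEPENDENCY: continuum YM on T⁴ ⇐ BetaPertH ∧ nine spine estimates (0/9 proved); BetaPertH ⇐ (D1) ∧ (D4) ∧ CAP+tail;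
G-an2-4 gates asym, D1 and NE2/3/4.
DERIVED cell leaf ([folklore] letter algebra and `4 × 4` word evaluation), BY NAME over G3′σ, G4-B′ (the family-independent letters `grad_ite_eq_sum`, `upF_sum'`,
`gmode1_single_eq`, `gmode2o_single_single`, `Ebg_eq_Yf ∕ Ebi_eq_Yb`, `c11_conj_ι`, `comm_ite_left`, the entries `ent_*`), an1's S2-series
(`SymAveragingMixedJetWords ∕ Tables ∕ Structure`: `symPhiGAt`, `symT2At`, `symVh2Tab`, `symT2At_ω_zero`; `SymAveragingHessianCounts*`: `symVhUAt_single`,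
`symHessUAt_single`, `symLinU_single`, `symHessCountAt_swap`; `SymRootedJetDictionary`: `symPhiGAt_add_top`, `c11_logT_symPhiGAt_Y`, `c10 ∕ c01_symPhiGAt_Y`,
`c00_symPhiGAt`, `inv_smul_sum_box_loopPAt`), 33J `c11_eq_logT_add`, 33K entries.  No statement of Bałaban's papers, no `[cite:]`, no `def`, no `Prop` fact;
no VALUE of any table asserted.  Discharges NO binder; 0∕4.  NOT D1, NOT `BetaPertH`, NOT continuum, NOT Clay.  «not in print; our bookkeeping».

WHAT (`r = L·y + ρ`, `r₊ = r + L·e_μ`, `ℓ = L^d`; `n = symLinCountAt`, `hess = symHessCountAt`, `m = symVhCountAt` — the (0.4) UNNORMALISED rooted counts of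
an1's S1; `s_sym = symVh2Tab`):
* §1 `symT2At_sub_ω ∕ symT2At_sum_ω`.
* §2 THE ROOT TERM on the pair family, generic `𝔸`: `fst_symPhiRAt_zero`, `fst_symPhiRAt_zero_eq_Y`, the components **`c10 ∕ c01 ∕ c11_fst_symPhiRAt_zero`**
  (`(d!·ℓ)⁻¹•S_B`, `(d!·ℓ)⁻¹•S_{B′}`, `(2(d!)²ℓ)⁻¹•(symHessUAt ρ B′ B + d!•S_{[B′,B]}) + (d!·ℓ)⁻¹•S_{[B,B′]} + (2(d!)²ℓ²)⁻¹•{S_B, S_{B′}}`).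
* §3 at `𝔸 = UT`, `λ = δ_u E₂₃`, `B = single g E₀₁`, `B′ = single h E₁₂`: `sym_root_entry_gh ∕ _hg` and **`symVh2Tab_siteWard₀`**:
  `Σ_κ (s_sym((κ, u − e_κ); g, h) − s_sym((κ, u); g, h)) = ((d!)²ℓ²)⁻¹·[u = h₊]·m(h, g) − (d!·ℓ)⁻¹·[g = h]·[u = g₊]·n(g) + [u = r₊]·(((d!)²ℓ)⁻¹·hess(g, h) + ((d!)²ℓ²)⁻¹·n(g)·n(h))`
  — same three contacts as G4-B′ (the second background rotated at its far end and paired with the first by the first-order count WITH THE SLOTS EXCHANGED; the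
  diagonal double rotation; the ROOT contact at the far end of the coarse bond), constants per an3-g63's dictionary.
READING toward the door (bookkeeping): `symVh2KerAt = symVh2Tab` cast to `ℝ`; `symVh₂SAt ρ L κ u = packVH (μ y f f′ ↦ symVh2KerAt ρ L μ y f (κ,u) f′) L`;
`symVh₂SAn1 d L κ u κ′ u′ = atw (½ • (symVh₂SAt ρ_c L κ u κ′ u′ + swap))` — the sequel packs this law (gan24-leaf-02's `SymBorderGaugeLegContact` pattern at order 1)
and periodises it (my g17 `PeriodisedBorderWardContact` pattern) into U21's `c2` right block with `Db₂` explicit.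
Provenance: D1 formalisation swarm LEAF PROVER 02, unit b2b-balaban-beta-d1-formalise-leaf-02 gen 23, 2026-08-23; no existing file touched.
-/

namespace Summit.QuantumFields.BalabanUV.Beta.SymBorderWardSiteLawFluct

open Finset
open scoped BigOperators Nat
open Literature.MathematicalPhysics.QuantumFieldTheory.Balaban1983to89
open Literature.MathematicalPhysics.QuantumFieldTheory.Balaban1983to89.Beta
open AffineAveraging (Form1 Site unitVec)
open AveragingContours (grad segUp)
open AveragingGaugeModes (gmode1)
open AveragingHessianKernels (Bond single single_apply bw bw_single)
open Summit.QuantumFields.BalabanUV.Beta.SymAveragingHessianCounts (symVhUAt symLinU symHessUAt symVhCountAt symHessCountAt symLinCountAt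
  symVhUAt_single symHessUAt_single symLinU_single symHessCountAt_swap loopPAt)
open AveragingThirdJet (Tau Rho dmk fst_dmk snd_dmk dfst_mul dsnd_mul upF upF_apply Ebg Ebi logT invT Yf Yb wU gmode2o)
open AveragingThirdJet.Tau (τ₁ τ₂ τ12 ι c00 c10 c01 c11 mk ext4)
open AveragingMixedJetTables (UT E)
open Summit.QuantumFields.BalabanUV.Beta.SymAveragingMixedJetTables (symPhiGAt map_symPhiGAt symQjetAt symT2At symPhiRAt symT2At_ω_zero symVh2Tab)
open Summit.QuantumFields.BalabanUV.Beta.RootedJetReflection (GfL GbL fst_GfL fst_GbL)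
open Summit.QuantumFields.BalabanUV.Beta.SymRootedJetReflection (symPhiLAt symPhiRAt_eq_symPhiLAt)
open Summit.QuantumFields.BalabanUV.Beta.SymRootedJetLinear (symT2At_add_ω symT2At_neg_ω)
open Summit.QuantumFields.BalabanUV.Beta.SymRootedJetDictionary (inv_smul_sum_box_loopPAt c11_logT_symPhiGAt_Y c00_symPhiGAt symPhiGAt_add_top
  c10_symPhiGAt_Y c01_symPhiGAt_Y)
open Summit.QuantumFields.BalabanUV.Beta.RootedT2JetDictionary (c11_eq_logT_add)
open Summit.QuantumFields.BalabanUV.Beta.RootedMixedTableLaw (ent_X2_ap ent_Xc_ap ite_entry)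
open Summit.QuantumFields.BalabanUV.Beta.BorderWardSiteLawFluct (grad_ite_eq_sum upF_sub' upF_sum' gmode1_single_eq gmode2o_single_single Ebg_eq_Yf Ebi_eq_Yb
  c11_conj_ι comm_ite_left ent_R1 ent_R2 ent_R3 ent_R6r ent_R7r ent_R4r ent_R5r)
open Summit.QuantumFields.BalabanUV.Beta.MixedWardSiteLaw (ent_W4_ap)
open Summit.QuantumFields.BalabanUV.Beta.BorderWardSiteLaw (ent_B2)
open Summit.QuantumFields.BalabanUV.Beta.SymBorderJetWardFluct (fst_symPhiLAt_zero_mul_fst_invT symT2At_gauge_fluct)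

variable {𝕜 : Type*} [Field 𝕜] {d : ℕ} {𝔸 : Type*} [Ring 𝔸] [Algebra 𝕜 𝔸]

/-! ## §1 Additivity of `symT2At` in the fluctuation -/

section Letters

/-- [folklore] `symT2At ρ` commutes with subtraction in the fluctuation. -/
theorem symT2At_sub_ω (ρ : Fin d → ℤ) (ω₁ ω₂ : Form1 d (Tau 𝔸)) (B B' : Form1 d 𝔸) (L : ℕ) (μ : Fin d) (y : Fin d → ℤ) :
    symT2At 𝕜 ρ (ω₁ - ω₂) B B' L μ y = symT2At 𝕜 ρ ω₁ B B' L μ y - symT2At 𝕜 ρ ω₂ B B' L μ y := by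
  rw [sub_eq_add_neg, symT2At_add_ω, symT2At_neg_ω, ← sub_eq_add_neg]

/-- [folklore] `symT2At ρ` commutes with finite sums in the fluctuation. -/
theorem symT2At_sum_ω {ι' : Type*} (s : Finset ι') (ω : ι' → Form1 d (Tau 𝔸)) (ρ : Fin d → ℤ) (B B' : Form1 d 𝔸) (L : ℕ) (μ : Fin d)
    (y : Fin d → ℤ) : symT2At 𝕜 ρ (∑ i ∈ s, ω i) B B' L μ y = ∑ i ∈ s, symT2At 𝕜 ρ (ω i) B B' L μ y := by
  classical
  induction s using Finset.induction_on with
  | empty => rw [Finset.sum_empty, Finset.sum_empty, symT2At_ω_zero]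
  | insert a s ha ih => rw [Finset.sum_insert ha, Finset.sum_insert ha, symT2At_add_ω, ih]

end Letters

/-! ## §2 The root term on the pair family: components of `symΦ₀ = (symPhiRAt ρ 0 B B′).fst` -/

section Root

/-- [folklore] `symΦ₀ = symPhiGAt (Ebg B B′) (Ebi B B′)`. -/
theorem fst_symPhiRAt_zero (ρ : Fin d → ℤ) (B B' : Form1 d 𝔸) (L : ℕ) (μ : Fin d) (y : Fin d → ℤ) :
    (symPhiRAt 𝕜 ρ 0 B B' L μ y).fst = symPhiGAt 𝕜 ρ (Ebg B B') (Ebi B B') L μ y := by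
  rw [symPhiRAt_eq_symPhiLAt]
  unfold symPhiLAt
  have key := map_symPhiGAt (TrivSqZeroExt.fstHom 𝕜 (Tau 𝔸) (Tau 𝔸)) ρ (GfL 0 (Ebg B B')) (GbL 0 (Ebi B B')) L μ y
  simp only [TrivSqZeroExt.fstHom_apply, fst_GfL, fst_GbL] at key
  exact key

/-- [folklore] `symΦ₀ = symΦ^ρ(Y(B′;B)) + τ₁τ₂·(c([B,B′]) + ((d!)²ℓ)⁻¹ ΣΣΣ loop([B,B′]))` (an1's `symPhiGAt_add_top`). -/
theorem fst_symPhiRAt_zero_eq_Y (ρ : Fin d → ℤ) (B B' : Form1 d 𝔸) (L : ℕ) (μ : Fin d) (y : Fin d → ℤ) :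
    (symPhiRAt 𝕜 ρ 0 B B' L μ y).fst
      = symPhiGAt 𝕜 ρ (Yf B' B) (Yb B' B) L μ y
        + mk 0 0 0 ((segUp (bw B B') ((L : ℤ) • y + ρ) μ L).sum
            + (((d ! : ℕ) : 𝕜) ^ 2 * (L : 𝕜) ^ d)⁻¹ • ∑ b ∈ AffineAveraging.box d L, ∑ σ : Equiv.Perm (Fin d), ∑ σ' : Equiv.Perm (Fin d),
                (loopPAt σ σ' ρ (bw B B') L μ y b).sum) := by
  rw [fst_symPhiRAt_zero, Ebg_eq_Yf, Ebi_eq_Yb]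
  exact symPhiGAt_add_top (fun κ x => by simp [Yf]) (fun κ x => by simp [Yb]) (bw B B') ρ L μ y

variable (hd : ((d ! : ℕ) : 𝕜) ≠ 0) {L : ℕ} (hL : (L : 𝕜) ≠ 0) (h2 : (2 : 𝕜) ≠ 0)
include hd hL

omit hd hL in
/-- [folklore] `c00 symΦ₀ = 1`. -/
theorem c00_fst_symPhiRAt_zero (ρ : Fin d → ℤ) (B B' : Form1 d 𝔸) (μ : Fin d) (y : Fin d → ℤ) : c00 (symPhiRAt 𝕜 ρ 0 B B' L μ y).fst = 1 := by
  rw [fst_symPhiRAt_zero]; exact c00_symPhiGAt (fun κ x => AveragingThirdJet.c00_Ebg _ _ κ x) (fun κ x => AveragingThirdJet.c00_Ebi _ _ κ x) ρ L μ y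

/-- [folklore] `c10 symΦ₀ = (d!·ℓ)⁻¹ • S_B`. -/
theorem c10_fst_symPhiRAt_zero (ρ : Fin d → ℤ) (B B' : Form1 d 𝔸) (μ : Fin d) (y : Fin d → ℤ) :
    c10 (symPhiRAt 𝕜 ρ 0 B B' L μ y).fst = (((d ! : ℕ) : 𝕜) * (L : 𝕜) ^ d)⁻¹ • symLinU ρ B L μ y := by
  rw [fst_symPhiRAt_zero_eq_Y, AveragingThirdJet.Tau.c10_add, AveragingThirdJet.Tau.c10_mk, add_zero, c10_symPhiGAt_Y hd hL]

/-- [folklore] `c01 symΦ₀ = (d!·ℓ)⁻¹ • S_{B′}`. -/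
theorem c01_fst_symPhiRAt_zero (ρ : Fin d → ℤ) (B B' : Form1 d 𝔸) (μ : Fin d) (y : Fin d → ℤ) :
    c01 (symPhiRAt 𝕜 ρ 0 B B' L μ y).fst = (((d ! : ℕ) : 𝕜) * (L : 𝕜) ^ d)⁻¹ • symLinU ρ B' L μ y := by
  rw [fst_symPhiRAt_zero_eq_Y, AveragingThirdJet.Tau.c01_add, AveragingThirdJet.Tau.c01_mk, add_zero, c01_symPhiGAt_Y hd hL]

include h2 in
/-- [folklore] **`c11 symΦ₀`**: the pure-background ordered-pair functional on the pair family —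
`(2(d!)²ℓ)⁻¹ • (symHessUAt ρ B′ B + d!•S_{[B′,B]}) + (d!·ℓ)⁻¹ • S_{[B,B′]} + (2(d!)²ℓ²)⁻¹ • {S_B, S_{B′}}`. -/
theorem c11_fst_symPhiRAt_zero (ρ : Fin d → ℤ) (B B' : Form1 d 𝔸) (μ : Fin d) (y : Fin d → ℤ) :
    c11 (symPhiRAt 𝕜 ρ 0 B B' L μ y).fst
      = ((2 : 𝕜) * ((((d ! : ℕ) : 𝕜)) ^ 2 * (L : 𝕜) ^ d))⁻¹ • (symHessUAt ρ B' B L μ y + ((d ! : ℕ) : ℤ) • symLinU ρ (bw B' B) L μ y)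
        + (((d ! : ℕ) : 𝕜) * (L : 𝕜) ^ d)⁻¹ • symLinU ρ (bw B B') L μ y
        + ((2 : 𝕜) * ((((d ! : ℕ) : 𝕜)) ^ 2 * (L : 𝕜) ^ (2 * d)))⁻¹ • (symLinU ρ B L μ y * symLinU ρ B' L μ y + symLinU ρ B' L μ y * symLinU ρ B L μ y) := by
  have hℓ : ((L : 𝕜) ^ d) ≠ 0 := pow_ne_zero d hL
  have h00 : c00 (symPhiGAt 𝕜 ρ (Yf B' B) (Yb B' B) L μ y) = 1 := c00_symPhiGAt (fun κ x => by simp [Yf]) (fun κ x => by simp [Yb]) ρ L μ y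
  rw [fst_symPhiRAt_zero_eq_Y, AveragingThirdJet.Tau.c11_add, AveragingThirdJet.Tau.c11_mk, inv_smul_sum_box_loopPAt ρ _ hd hL, add_sub_cancel,
    c11_eq_logT_add (𝕜 := 𝕜) _ h00, c11_logT_symPhiGAt_Y ρ _ _ hd hL h2, c10_symPhiGAt_Y hd hL, c01_symPhiGAt_Y hd hL]
  simp only [smul_add, smul_mul_assoc, mul_smul_comm, smul_smul, pow_mul', sq]
  match_scalars <;> (field_simp; try ring)

end Root

/-! ## §3 The site law of `symVh2Tab` in its FIRST (fluctuation) slot, every site -/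

section Tables

/-- [folklore] `(d! : ℚ) ≠ 0`. -/
theorem factorial_cast_ne_zero (d : ℕ) : ((d ! : ℕ) : ℚ) ≠ 0 := by exact_mod_cast (Nat.factorial_pos d).ne'

variable {d L : ℕ} (hL : (L : ℚ) ≠ 0)
include hL

open Classical in
/-- [folklore] The `(0,3)` entry of the ROOT TERM on the pair family, order `(B, B′)`. -/
theorem sym_root_entry_gh (ρ : Fin d → ℤ) (μ : Fin d) (y u : Fin d → ℤ) (g h : Bond d) :
    c11 ((symPhiRAt ℚ ρ 0 (single g (E 0 1)) (single h (E 1 2)) L μ y).fst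
          * ι (if (L : ℤ) • y + ρ + (L : ℤ) • unitVec μ = u then E 2 3 else 0)
          * (invT (symPhiRAt ℚ ρ 0 (single g (E 0 1)) (single h (E 1 2)) L μ y)).fst) 0 3
      = (if (L : ℤ) • y + ρ + (L : ℤ) • unitVec μ = u then (1 : ℚ) else 0)
          * (((2 : ℚ) * ((((d ! : ℕ) : ℚ)) ^ 2 * (L : ℚ) ^ d))⁻¹
                * (-(symHessCountAt ρ L μ y h g : ℚ) - ((d ! : ℕ) : ℚ) * (if h = g then (symLinCountAt ρ L μ y h : ℚ) else 0))
              + (((d ! : ℕ) : ℚ) * (L : ℚ) ^ d)⁻¹ * (if g = h then (symLinCountAt ρ L μ y g : ℚ) else 0)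
              + ((2 : ℚ) * ((((d ! : ℕ) : ℚ)) ^ 2 * (L : ℚ) ^ (2 * d)))⁻¹ * ((symLinCountAt ρ L μ y g : ℚ) * (symLinCountAt ρ L μ y h : ℚ))) := by
  have hd := factorial_cast_ne_zero d
  have hX : c00 (symPhiRAt ℚ ρ 0 (single g (E 0 1)) (single h (E 1 2)) L μ y).fst = 1 := c00_fst_symPhiRAt_zero ρ _ _ μ y
  have hXP := fst_symPhiLAt_zero_mul_fst_invT (𝕜 := ℚ) (E := Ebg (single g (E 0 1)) (single h (E 1 2))) (Eb := Ebi (single g (E 0 1)) (single h (E 1 2)))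
    (fun κ x => AveragingThirdJet.c00_Ebg _ _ κ x) (fun κ x => AveragingThirdJet.c00_Ebi _ _ κ x) ρ L μ y
  rw [← symPhiRAt_eq_symPhiLAt] at hXP
  by_cases hu : (L : ℤ) • y + ρ + (L : ℤ) • unitVec μ = u
  · rw [if_pos hu, if_pos hu, one_mul, c11_conj_ι _ _ hX hXP, c11_fst_symPhiRAt_zero hd hL two_ne_zero, c10_fst_symPhiRAt_zero hd hL,
      c01_fst_symPhiRAt_zero hd hL, symHessUAt_single, bw_single, bw_single, symLinU_single, symLinU_single, symLinU_single, symLinU_single]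
    simp only [← Int.cast_smul_eq_zsmul ℚ, smul_add, smul_ite, smul_zero, Matrix.add_mul, Matrix.mul_add,
      Matrix.smul_mul, Matrix.mul_smul, smul_smul, ite_mul, mul_ite, zero_mul, mul_zero, Matrix.mul_assoc,
      Matrix.add_apply, Matrix.sub_apply, Matrix.smul_apply, ite_entry, ent_R1, ent_R2, ent_R3, ent_R6r, ent_R7r, ent_R4r, ent_R5r, smul_eq_mul, mul_one,
      mul_zero, mul_neg, add_zero, sub_zero, zero_add, Int.cast_natCast]
    by_cases hgh : g = h
    · subst hgh; simp only [if_true]; ring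
    · have hhg : ¬ h = g := fun e => hgh e.symm
      simp only [hgh, hhg, if_false]; ring
  · rw [if_neg hu, if_neg hu, zero_mul, AveragingThirdJet.ι_zero, mul_zero, zero_mul, AveragingThirdJet.Tau.c11_zero]
    rfl

open Classical in
/-- [folklore] The `(0,3)` entry of the ROOT TERM on the pair family, order `(B′, B)`. -/
theorem sym_root_entry_hg (ρ : Fin d → ℤ) (μ : Fin d) (y u : Fin d → ℤ) (g h : Bond d) :
    c11 ((symPhiRAt ℚ ρ 0 (single h (E 1 2)) (single g (E 0 1)) L μ y).fst
          * ι (if (L : ℤ) • y + ρ + (L : ℤ) • unitVec μ = u then E 2 3 else 0)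
          * (invT (symPhiRAt ℚ ρ 0 (single h (E 1 2)) (single g (E 0 1)) L μ y)).fst) 0 3
      = (if (L : ℤ) • y + ρ + (L : ℤ) • unitVec μ = u then (1 : ℚ) else 0)
          * (((2 : ℚ) * ((((d ! : ℕ) : ℚ)) ^ 2 * (L : ℚ) ^ d))⁻¹
                * ((symHessCountAt ρ L μ y g h : ℚ) + ((d ! : ℕ) : ℚ) * (if g = h then (symLinCountAt ρ L μ y g : ℚ) else 0))
              - (((d ! : ℕ) : ℚ) * (L : ℚ) ^ d)⁻¹ * (if h = g then (symLinCountAt ρ L μ y h : ℚ) else 0)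
              + ((2 : ℚ) * ((((d ! : ℕ) : ℚ)) ^ 2 * (L : ℚ) ^ (2 * d)))⁻¹ * ((symLinCountAt ρ L μ y g : ℚ) * (symLinCountAt ρ L μ y h : ℚ))) := by
  have hd := factorial_cast_ne_zero d
  have hX : c00 (symPhiRAt ℚ ρ 0 (single h (E 1 2)) (single g (E 0 1)) L μ y).fst = 1 := c00_fst_symPhiRAt_zero ρ _ _ μ y
  have hXP := fst_symPhiLAt_zero_mul_fst_invT (𝕜 := ℚ) (E := Ebg (single h (E 1 2)) (single g (E 0 1))) (Eb := Ebi (single h (E 1 2)) (single g (E 0 1)))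
    (fun κ x => AveragingThirdJet.c00_Ebg _ _ κ x) (fun κ x => AveragingThirdJet.c00_Ebi _ _ κ x) ρ L μ y
  rw [← symPhiRAt_eq_symPhiLAt] at hXP
  by_cases hu : (L : ℤ) • y + ρ + (L : ℤ) • unitVec μ = u
  · rw [if_pos hu, if_pos hu, one_mul, c11_conj_ι _ _ hX hXP, c11_fst_symPhiRAt_zero hd hL two_ne_zero, c10_fst_symPhiRAt_zero hd hL,
      c01_fst_symPhiRAt_zero hd hL, symHessUAt_single, bw_single, bw_single, symLinU_single, symLinU_single, symLinU_single, symLinU_single]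
    simp only [← Int.cast_smul_eq_zsmul ℚ, smul_add, smul_ite, smul_zero, Matrix.add_mul, Matrix.mul_add,
      Matrix.smul_mul, Matrix.mul_smul, smul_smul, ite_mul, mul_ite, zero_mul, mul_zero, Matrix.mul_assoc,
      Matrix.add_apply, Matrix.sub_apply, Matrix.smul_apply, ite_entry, ent_R1, ent_R2, ent_R3, ent_R6r, ent_R7r, ent_R4r, ent_R5r, smul_eq_mul, mul_one,
      mul_zero, mul_neg, add_zero, sub_zero, zero_add, Int.cast_natCast]
    by_cases hgh : g = h
    · subst hgh; simp only [if_true]; ring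
    · have hhg : ¬ h = g := fun e => hgh e.symm
      simp only [hgh, hhg, if_false]; ring
  · rw [if_neg hu, if_neg hu, zero_mul, AveragingThirdJet.ι_zero, mul_zero, zero_mul, AveragingThirdJet.Tau.c11_zero]
    rfl

set_option maxHeartbeats 800000 in
open Classical in
/-- [folklore] **THE SITE LAW OF `symVh2Tab` IN ITS FIRST (FLUCTUATION) SLOT** (ℚ, general `d`, any root `ρ`, `(L:ℚ) ≠ 0`; EVERY site `u`): with
`ℓ = L^d`, `n = symLinCountAt`, `hess = symHessCountAt`, `m = symVhCountAt` (the (0.4) UNNORMALISED counts),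
`Σ_κ (s_sym((κ, u − e_κ); g, h) − s_sym((κ, u); g, h)) = ((d!)²ℓ²)⁻¹·[u = h₊]·m(h, g) − (d!·ℓ)⁻¹·[g = h]·[u = g₊]·n(g) + [u = r₊]·(((d!)²ℓ)⁻¹·hess(g, h) + ((d!)²ℓ²)⁻¹·n(g)·n(h))`
— the (0.4) twin of G4-B′ `vh2Tab_siteWard₀` under an3-g63's dictionary of constants. -/
theorem symVh2Tab_siteWard₀ (ρ : Fin d → ℤ) (μ : Fin d) (y u : Fin d → ℤ) (g h : Bond d) :
    ∑ κ : Fin d, (symVh2Tab ρ L μ y (κ, u - unitVec κ) g h - symVh2Tab ρ L μ y (κ, u) g h)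
      = ((((d ! : ℕ) : ℚ)) ^ 2 * (L : ℚ) ^ (2 * d))⁻¹ * (if h.2 + unitVec h.1 = u then (1 : ℚ) else 0) * (symVhCountAt ρ L μ y h g : ℚ)
        - (((d ! : ℕ) : ℚ) * (L : ℚ) ^ d)⁻¹ * (if g = h ∧ g.2 + unitVec g.1 = u then (1 : ℚ) else 0) * (symLinCountAt ρ L μ y g : ℚ)
        + (if (L : ℤ) • y + ρ + (L : ℤ) • unitVec μ = u then (1 : ℚ) else 0)
            * (((((d ! : ℕ) : ℚ)) ^ 2 * (L : ℚ) ^ d)⁻¹ * (symHessCountAt ρ L μ y g h : ℚ)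
              + ((((d ! : ℕ) : ℚ)) ^ 2 * (L : ℚ) ^ (2 * d))⁻¹ * ((symLinCountAt ρ L μ y g : ℚ) * (symLinCountAt ρ L μ y h : ℚ))) := by
  have hd := factorial_cast_ne_zero d
  have key := symT2At_gauge_fluct (𝕜 := ℚ) (𝔸 := UT) (fun x' : Site d => if x' = u then E 2 3 else 0) hd hL two_ne_zero ρ
    (single g (E 0 1)) (single h (E 1 2)) μ y
  simp only [grad_ite_eq_sum, upF_sum', upF_sub', symT2At_sum_ω, symT2At_sub_ω, gmode1_single_eq, gmode2o_single_single, symVhUAt_single,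
    symLinU_single, comm_ite_left] at key
  have k := congrFun (congrFun key 0) 3
  simp only [Matrix.sum_apply, Matrix.sub_apply, Matrix.add_apply, Matrix.smul_apply, ← Int.cast_smul_eq_zsmul ℚ, smul_ite, smul_zero, ite_entry,
    ent_Xc_ap, ent_B2, ent_X2_ap, ent_W4_ap, smul_eq_mul, mul_zero, mul_one, mul_neg, sym_root_entry_gh hL, sym_root_entry_hg hL] at k
  have hs : ∀ f : Bond d, symVh2Tab ρ L μ y f g h = symT2At ℚ ρ (upF (single f (E 2 3))) (single g (E 0 1)) (single h (E 1 2)) L μ y 0 3 :=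
    fun f => rfl
  simp only [hs]
  rw [k, symHessCountAt_swap ρ L μ y g h]
  push_cast
  by_cases hgh : g = h
  · subst hgh
    simp only [true_and, if_true]
    split_ifs <;> field_simp <;> ring
  · have hhg : ¬ h = g := fun e => hgh e.symm
    simp only [hgh, hhg, false_and, if_false]
    split_ifs <;> field_simp <;> ring

end Tables

end Summit.QuantumFields.BalabanUV.Beta.SymBorderWardSiteLawFluct
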